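import Mathlib
import Summits.HodgeConjecture.FermatCycles.HodgeFermatLemmaENu

/-!
# The characters `χ₃ × ψ` mod `3p` and LEMMA E (ν-part) in `ψ`-form (`HodgeFermat/NuChar.lean`)

Tree copy (whole module) of the module `HodgeFermat/NuChar.lean` of the sibling cell's standalone package
`run/shared/lean/pub/pub-hodgefermat/lean/HodgeFermat/` (163 lines, sha256 `8fd55d5c01168350…`), source lines 27–163 (all).
Filed by cell `pub-hfermat`, seat prover-1 gen-0, on the COORDINATOR KEEPER RULING of 2026-08-25 (gem sweep H1: take the
off-gate kernel theorem `thmFstar` — `HodgeFermat/DecodingFinal.lean:29` — through the gate); this file is one link of the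
minimal import closure of `thmFstar`.  The source module's declarations are VERBATIM those of the cell record
`check/DecodingFinal_standalone.lean` (27 bodies, 454 223 B, sha256 dca6f17de93119a6…, hub `lean check` rc 0, 130.1 s; pub-hodgefermat `CERT.md` l.978, GATE HF-G32).
Deviations from the source module, exhaustively: the `import` lines (tree modules `Summits.HodgeConjecture.FermatCycles.
HodgeFermat*` instead of `HodgeFermat.*`); this module docstring; one-line docstrings added (gate lint) to `quadraticChar_three`, `chi3C_natCast`, `chi3C_inv`, `chi3Mul_natCast`, `chi3Mul_inv`, `nhat_chi3Mul`.
Every other line — in particular every declaration's statement and proof — is byte-identical to the source.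
HONEST FRAMING: explicit algebraic cycles for specific Hodge classes on Fermat/Delsarte varieties; residual open instances
listed; no claim on general Hodge.  (This file is arithmetic of CM types; it claims nothing about cycles.)

The source module's docstring (NuChar.lean l.3–25), verbatim:

## LEMMA E (ν-part, m₀ = 3) at a prime level for the characters `χ₃ × ψ`, `ψ` even `≠ 1` (HF-G31d)

`HodgeFermat/LemmaENu.lean` proves the ν-part of LEMMA E (`tables/DPRIME-THEOREM.md` §6, `m₀ = 3`) at a prime
level `p` for every odd character `χ` mod `3p` that is non-trivial on the kernels of both reductions
(`lemmaE_nu`, from `H0`).  THIS FILE constructs the characters DPRIME §7.1 actually uses — `χ = χ₃ × ψ` with `ψ`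
an EVEN, NON-TRIVIAL Dirichlet character mod `p` — as Mathlib Dirichlet characters mod `3p` and reads LEMMA E off:

* `chi3C : DirichletCharacter ℂ 3` — the quadratic character mod 3 (`quadraticChar (ZMod 3)` with complex values),
  `chi3C_natCast : chi3C x = chi3 x` (`chi3` of `ChiThree`); `chi3Mul ψ : DirichletCharacter ℂ (3 * p)` — the
  product of the lifts; `chi3Mul_natCast : chi3Mul ψ x = chi3 x * ψ x` for `x` prime to `3p`; `chi3Mul_inv`,
  `chi3Mul_odd` (`ψ` even ⟹ `χ₃ × ψ` odd), `chi3Mul_ram` (value `-1 ≠ 1` at the units `j ≡ 2 (3)`, `j ≡ 1 (p)`),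
  `chi3Mul_ne_one` (`ψ ≠ 1` ⟹ a unit `k ≡ 1 (3)` with `χ(k) ≠ 1`, Chinese remainder);
* `nu3 ψ x = χ₃(x)·ψ⁻¹(x)` (`3 ∤ x`), `0` (`3 ∣ x`) — the ν-weight, `nhat (chi3Mul ψ) x = nu3 ψ x` (`nhat_chi3Mul`);
* **`lemmaE_nu3 (h0 : H0) (hp : p.Prime) (hp3 : p ≠ 3) (ψ : DirichletCharacter ℂ p) (hψ : ψ.Even) (hψ1 : ψ ≠ 1) …
  (hT : SameType (3 * p) (a, b, c) (a', b', c')) : nu3 ψ a + nu3 ψ b + nu3 ψ c = nu3 ψ a' + nu3 ψ b' + nu3 ψ c'`** —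
  "ν̂_T(ψ̄) = ν̂_T′(ψ̄) for every even ψ ≠ 1" of DPRIME §7.1, for two zero-sum triples mod `3p` with entries prime
  to `p` and the same CM type (the case `ψ = 1` is THEOREM (Σν) of `ChiThree`, which needs `p ≢ 1 (mod 3)`).
`HodgeFermat/LemmaENuFinal.lean` discharges `h0` by `HurwitzZero.hypH0`.

LIGHT module: imports `LemmaENu`; no `sorry`; no `decide`; axioms [propext, Classical.choice, Quot.sound]
(hub record `check/NuChar_standalone.lean`).  NOT imported by the root `HodgeFermat.lean`.
-/

namespace HodgeFermat.KRFree.NuChar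

open Finset HodgeFermat.KRFree.LemmaN HodgeFermat.KRFree.TwistedMoment
open HodgeFermat.KRFree.ChiThree (units chi3 chi3_mul chi3_of_dvd coprime_mod_iff)
open HodgeFermat.KRFree.LemmaEMu (H0 toFun)
open HodgeFermat.KRFree.LemmaENu (nhat lemmaE_nu)

/-! ## 1. `χ₃` as a complex Dirichlet character mod 3 -/

/-- the quadratic character mod `3` with values in `ℂ` -/
noncomputable def chi3C : DirichletCharacter ℂ 3 := (quadraticChar (ZMod 3)).ringHomComp (Int.castRingHom ℂ)

/-- the quadratic character of `ZMod 3` agrees with `chi3` on naturals -/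
lemma quadraticChar_three (x : ℕ) : quadraticChar (ZMod 3) (x : ZMod 3) = chi3 x := by
  have hx : (x : ZMod 3) = ((x % 3 : ℕ) : ZMod 3) := (ZMod.natCast_mod x 3).symm
  have h : x % 3 = 0 ∨ x % 3 = 1 ∨ x % 3 = 2 := by omega
  unfold chi3
  rcases h with h | h | h
  · rw [hx, h, Nat.cast_zero, quadraticChar_zero]
    simp
  · rw [hx, h, Nat.cast_one, map_one]
    simp
  · have hF : ringChar (ZMod 3) ≠ 2 := by rw [ZMod.ringChar_zmod_n]; norm_num
    have e : ((2 : ℕ) : ZMod 3) = -1 := by decide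
    rw [hx, h, e, quadraticChar_neg_one hF, ZMod.card, ZMod.χ₄_nat_three_mod_four (by norm_num)]
    simp

/-- `chi3C` agrees with `chi3` on naturals -/
lemma chi3C_natCast (x : ℕ) : chi3C (x : ZMod 3) = (chi3 x : ℂ) := by
  unfold chi3C
  rw [MulChar.ringHomComp_apply, quadraticChar_three]
  simp

/-- `chi3C` is its own inverse -/
lemma chi3C_inv : chi3C⁻¹ = chi3C := by
  unfold chi3C
  rw [MulChar.ringHomComp_inv, (quadraticChar_isQuadratic (ZMod 3)).inv]

/-! ## 2. `χ₃ × ψ` mod `3p` -/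

variable {p : ℕ}

/-- `χ₃ × ψ` as a Dirichlet character mod `3p` (product of the lifts of `χ₃` mod 3 and `ψ` mod `p`) -/
noncomputable def chi3Mul (ψ : DirichletCharacter ℂ p) : DirichletCharacter ℂ (3 * p) :=
  DirichletCharacter.changeLevel (dvd_mul_right 3 p) chi3C
    * DirichletCharacter.changeLevel (dvd_mul_left p 3) ψ

/-- `(χ₃ × ψ)(x) = χ₃(x)·ψ(x)` for `x` prime to `3p` -/
lemma chi3Mul_natCast (ψ : DirichletCharacter ℂ p) {x : ℕ} (hx : Nat.Coprime x (3 * p)) :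
    chi3Mul ψ (x : ZMod (3 * p)) = (chi3 x : ℂ) * ψ (x : ZMod p) := by
  unfold chi3Mul
  rw [MulChar.mul_apply, ← ZMod.coe_unitOfCoprime x hx,
    DirichletCharacter.changeLevel_eq_cast_of_dvd chi3C (dvd_mul_right 3 p),
    DirichletCharacter.changeLevel_eq_cast_of_dvd ψ (dvd_mul_left p 3), ZMod.coe_unitOfCoprime,
    ZMod.cast_natCast (dvd_mul_right 3 p), ZMod.cast_natCast (dvd_mul_left p 3), chi3C_natCast]

/-- `(χ₃ × ψ)⁻¹ = χ₃ × ψ⁻¹` -/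
lemma chi3Mul_inv (ψ : DirichletCharacter ℂ p) : (chi3Mul ψ)⁻¹ = chi3Mul ψ⁻¹ := by
  unfold chi3Mul
  rw [mul_inv, ← map_inv, ← map_inv, chi3C_inv]

/-- `ψ` even ⟹ `χ₃ × ψ` odd -/
lemma chi3Mul_odd (hp : p.Prime) (ψ : DirichletCharacter ℂ p) (hψ : ψ.Even) : (chi3Mul ψ).Odd := by
  have h1 : 1 ≤ 3 * p := by have := hp.one_lt; omega
  have hcop : Nat.Coprime (3 * p - 1) (3 * p) := by
    have h : Nat.Coprime (3 * p - 1 + 1) (3 * p - 1) := Nat.coprime_self_add_left.mpr (Nat.coprime_one_left _)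
    rw [Nat.sub_add_cancel h1] at h
    exact Nat.coprime_comm.mp h
  show chi3Mul ψ (-1) = -1
  have e : (-1 : ZMod (3 * p)) = ((3 * p - 1 : ℕ) : ZMod (3 * p)) := by
    rw [Nat.cast_sub h1, ZMod.natCast_self, Nat.cast_one, zero_sub]
  have e' : ((3 * p - 1 : ℕ) : ZMod p) = -1 := by
    rw [Nat.cast_sub h1, Nat.cast_mul, ZMod.natCast_self, mul_zero, Nat.cast_one, zero_sub]
  have e3 : chi3 (3 * p - 1) = -1 := by
    unfold chi3
    have : (3 * p - 1) % 3 = 2 := by omega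
    simp [this]
  rw [e, chi3Mul_natCast ψ hcop, e', e3]
  rw [show ψ (-1) = 1 from hψ]
  push_cast
  ring

/-- ramification at `3`: `(χ₃ × ψ)(j) = -1 ≠ 1` for the units `j ≡ 2 (mod 3)`, `j ≡ 1 (mod p)` -/
lemma chi3Mul_ram (ψ : DirichletCharacter ℂ p) {j : ℕ} (hj : Nat.Coprime j (3 * p))
    (hj3 : j % 3 = 2) (hjp : j % p = 1 % p) : chi3Mul ψ (j : ZMod (3 * p)) ≠ 1 := by
  have e1 : ((j : ℕ) : ZMod p) = 1 := by
    rw [← Nat.cast_one]; exact (ZMod.natCast_eq_natCast_iff' j 1 p).mpr hjp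
  have e3 : chi3 j = -1 := by unfold chi3; simp [hj3]
  rw [chi3Mul_natCast ψ hj, e1, map_one, e3]
  norm_num

/-- `ψ ≠ 1` ⟹ `χ₃ × ψ` is `≠ 1` at some unit `k ≡ 1 (mod 3)` (Chinese remainder) -/
lemma chi3Mul_ne_one (hp : p.Prime) (hp3 : p ≠ 3) (ψ : DirichletCharacter ℂ p) (hψ1 : ψ ≠ 1) :
    ∃ k : ℕ, Nat.Coprime k (3 * p) ∧ k % 3 = 1 ∧ chi3Mul ψ (k : ZMod (3 * p)) ≠ 1 := by
  haveI : NeZero p := ⟨hp.ne_zero⟩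
  obtain ⟨v, hv⟩ := MulChar.ne_one_iff.mp hψ1
  have co : Nat.Coprime 3 p := (Nat.coprime_primes Nat.prime_three hp).mpr hp3.symm
  obtain ⟨k, hk3, hkp⟩ := Nat.chineseRemainder co 1 (v : ZMod p).val
  have hk3' : k % 3 = 1 := by unfold Nat.ModEq at hk3; omega
  have hkp' : k % p = (v : ZMod p).val % p := hkp
  have hkcp : Nat.Coprime k p := by
    rw [← coprime_mod_iff, hkp', coprime_mod_iff]
    exact ZMod.val_coe_unit_coprime v
  have hk : Nat.Coprime k (3 * p) :=
    coprime_three_mul_iff.mpr ⟨by omega, hkcp⟩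
  refine ⟨k, hk, hk3', ?_⟩
  have ek : ((k : ℕ) : ZMod p) = (v : ZMod p) := by
    rw [(ZMod.natCast_eq_natCast_iff' k (v : ZMod p).val p).mpr hkp', ZMod.natCast_zmod_val]
  have e3 : chi3 k = 1 := by unfold chi3; simp [hk3']
  rw [chi3Mul_natCast ψ hk, ek, e3]
  simpa using hv

/-! ## 3. The ν-weight and LEMMA E for `χ₃ × ψ` -/

/-- the ν-weight of (E0) for `χ = χ₃ × ψ`: `χ₃(x)·ψ⁻¹(x)` if `3 ∤ x`, `0` if `3 ∣ x` -/
noncomputable def nu3 (ψ : DirichletCharacter ℂ p) (x : ℕ) : ℂ :=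
  if 3 ∣ x then 0 else (chi3 x : ℂ) * ψ⁻¹ (x : ZMod p)

/-- dictionary: `nhat (χ₃ × ψ) = nu3 ψ` on arguments prime to `p` -/
lemma nhat_chi3Mul (ψ : DirichletCharacter ℂ p) {x : ℕ} (hx : Nat.Coprime x p) :
    nhat (chi3Mul ψ) x = nu3 ψ x := by
  unfold nhat nu3
  by_cases h3 : 3 ∣ x
  · rw [if_pos h3, if_pos h3]
  · rw [if_neg h3, if_neg h3, chi3Mul_inv, chi3Mul_natCast ψ⁻¹ (coprime_three_mul_iff.mpr ⟨h3, hx⟩)]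

/-- **LEMMA E (ν-part, m₀ = 3, prime level, χ = χ₃ × ψ; from H0).**  Let `p ≠ 3` be a prime, `ψ ≠ 1` an EVEN
Dirichlet character mod `p`, and `T = (a, b, c)`, `T′ = (a′, b′, c′)` two triples with zero sums mod `3p`, all entries
prime to `p`, and the same CM type at level `3p`.  Then `Σ_{x ∈ T, 3 ∤ x} χ₃(x)ψ⁻¹(x) = Σ_{x ∈ T′, 3 ∤ x} χ₃(x)ψ⁻¹(x)`
— "ν̂_T(ψ̄) = ν̂_T′(ψ̄) for every even ψ ≠ 1" (DPRIME §7.1). -/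
theorem lemmaE_nu3 (h0 : H0) (hp : p.Prime) (hp3 : p ≠ 3) (ψ : DirichletCharacter ℂ p) (hψ : ψ.Even)
    (hψ1 : ψ ≠ 1) {a b c a' b' c' : ℕ} (hs : 3 * p ∣ a + b + c) (hs' : 3 * p ∣ a' + b' + c')
    (ha : Nat.Coprime a p) (hb : Nat.Coprime b p) (hc : Nat.Coprime c p)
    (ha' : Nat.Coprime a' p) (hb' : Nat.Coprime b' p) (hc' : Nat.Coprime c' p)
    (hT : SameType (3 * p) (a, b, c) (a', b', c')) :
    nu3 ψ a + nu3 ψ b + nu3 ψ c = nu3 ψ a' + nu3 ψ b' + nu3 ψ c' := by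
  have key := lemmaE_nu h0 hp hp3 (chi3Mul ψ) (chi3Mul_odd hp ψ hψ)
    (fun j hj hj3 hjp => chi3Mul_ram ψ hj hj3 hjp) (chi3Mul_ne_one hp hp3 ψ hψ1)
    hs hs' ha hb hc ha' hb' hc' hT
  simpa only [nhat_chi3Mul ψ ha, nhat_chi3Mul ψ hb, nhat_chi3Mul ψ hc, nhat_chi3Mul ψ ha',
    nhat_chi3Mul ψ hb', nhat_chi3Mul ψ hc'] using key

end HodgeFermat.KRFree.NuChar
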